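import Summits.Schanuel.Schanuel.Theorems.DiophantineDichotomyApproximationPropertyPointAPThreeDeficient
import Summits.Schanuel.Schanuel.Theorems.DiophantineDichotomyApproximationPropertyHighSatelliteOf
import Summits.Schanuel.Schanuel.Theorems.DiophantineDichotomyApproximationPropertyPointDatumOfCloseZero
import Summits.Schanuel.Schanuel.Theorems.DiophantineDichotomyApproximationPropertyIdegLeMulOfRankTwo
import Summits.Schanuel.Schanuel.Theorems.DiophantineDichotomyApproximationPropertyExistsPrimeFactorMem
import HarnessLib

/-!
# `PointAPAbsAt 3` and the crux CONDITIONALLY on the MID-satellite kernel only (crux `ApproximationProperty`, stmt-Schanuel-6117) — record of skeleton v24/v25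

Crux `stmt-Schanuel-6117` (`Summit.Schanuel.Schanuel.Theses.DiophantineDichotomy.ApproximationProperty`), route
`DiophantineDichotomy`, line `orbit-interpolation-determinant`, lead c12 (`prover-line-stmt-Schanuel-6117-c12-0`,
skeleton v24/v25, `Cruxes/ApproximationProperty/Lines/orbit_interpolation_determinant.lean`, KERNEL-c12.md).

This file LANDS, as real theorems with ONE explicit hypothesis (no `sorry`, no definition, no named fact), the successor
of …PointAPThreeDeficient.lean (p140489, hypothesis `hfarDef` = v23b's far stub: far ∧ thin ∧ enveloped ∧ deficient
satellite). What changed: the HIGH range of the far kernel is a theorem of the tree —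
`pointDatum_of_highSatellite3` below, composed BY NAME from the landed `highSatellite3_of` (…HighSatelliteOf.lean:
two-form Bézout non-membership + envelope transport + Nesterenko's Prop. 4.11 with `r = 1` ⇒ the closest conjugate is a
datum, for satellites of degree `deg 𝔮' ≥ ηΔ²`, every `η > 0`) over `pointDatum_of_closeZero` (p152666),
`ideg_le_mul_of_rankTwo` (p152847) and `exists_primeFactor_mem` (p152931). Hence v23b's far stub follows from the MID
stub alone (`farSatellite3_def_of_mid`: case split at `ηΔ² ≤ deg 𝔮'`, boosts multiplied), and so do `PointAPAbsAt 3`,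
the `t = 3` slice and — with Philippon's conjecture for `n ≥ 4` — the crux (`approximationProperty_of_mid`, registered
sub-goal). The hypothesis `hmid` is the registered OPEN stub `pointDatum_of_midSatellite3` verbatim: v23b's far stub with
the extra hypothesis `deg 𝔮' < ηΔ²`, `η > 0` at the stub's disposal — the open content of Philippon's AP2 at `n = 3` in
this line now lives on satellites of degree `δ⋆ < deg 𝔮' < ηΔ²` (KERNEL-c12.md §3).

Sources: Nesterenko–Philippon (eds.), LNM 1752 (2001) Ch. 3 §4 (Prop. 4.11), Ch. 4 §4 p. 61 (AP1/AP2); Philippon,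
Publ. Math. IHÉS 64 (1986) §3.
-/

set_option linter.dupNamespace false

noncomputable section

attribute [local instance] MvPolynomial.gradedAlgebra

namespace Summit.Schanuel.Schanuel.Cruxes.ApproximationProperty.OrbitInterpolationDeterminant

open Summit.Schanuel.Schanuel.Theses.DiophantineDichotomy (ApproximationProperty)
open Literature.NumberTheory.Transcendental.Nesterenko MvPolynomial
open scoped BigOperators

/-- **`pointDatum_of_highSatellite3` — the HIGH range of the far-satellite kernel, UNCONDITIONAL**: composed BY NAME
from the landed `highSatellite3_of` over `pointDatum_of_closeZero`, `ideg_le_mul_of_rankTwo`, `exists_primeFactor_mem`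
(skeleton v24's four provable stubs). For every `ω, c₁ ≥ 1, C₄ ≥ c₁, η > 0`: boost `8` and a constant `c` such that a datum
of the clause-free descent at `(Δ, 8Y)` whose orbit lies on an enveloping rank-2 satellite of degree `≥ ηΔ²` yields a
`PointAPAbsAt 3`-datum at `(Δ, Y)`. [cite: NesterenkoPhilippon2001, Ch. 3 Prop. 4.11 (pp. 40–41); Ch. 4 §4 (p. 61)] -/
theorem pointDatum_of_highSatellite3 : ∀ (ω : Fin 3 → ℂ) (c₁ : ℝ), 1 ≤ c₁ → ∀ C₄ : ℝ, c₁ ≤ C₄ → ∀ η : ℝ, 0 < η → ∃ lam : ℝ, 1 ≤ lam ∧ ∃ c : ℝ, c₁ ≤ c ∧ ∀ Δ Y : ℝ, c ≤ Δ → Δ ≤ Y → ∀ (Q : Rx 3) (a : ℕ) (P : Rx 3) (b : ℕ) (𝔮 : Ideal (Rx 3)) (T : Rx 3) (τ : ℕ) (𝔭 𝔮' : Ideal (Rx 3)), CycleAP3Datum ω c₁ Δ (lam * Y) Q a P b 𝔮 T τ 𝔭 → 𝔮'.IsPrime → 𝔮'.IsHomogeneous (homogeneousSubmodule (Fin (3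 + 1)) ℚ) → IsUnmixedOfRank 𝔮' 2 → 𝔮' ∈ (Ideal.span {Q} ⊔ Ideal.span {P}).minimalPrimes → 𝔮' ≤ 𝔭 → homogeneousSubmodule (Fin (3 + 1)) ℚ ⌊C₄ * Δ⌋₊ ⊓ 𝔭.restrictScalars ℚ ≤ 𝔮'.restrictScalars ℚ → η * Δ ^ 2 ≤ (ideg 𝔮' 2 : ℝ) → ∃ (K : Type) (_ : Field K) (_ : NumberField K) (β : Fin 3 → K) (σ : K →+* ℂ), (Module.finrank ℚ K : ℝ) ≤ (c * Δ) ^ 3 ∧ Height.logHeight (Fin.cons (1 : K) β : Fin (3 + 1) → K) ≤ c * Y * Δ ^ 2 ∧ ‖(fun j => σ (β j)) - ω‖ ≤ Real.exp (-((Δ * Height.logHeight (Fin.cons (1 : K) β : Fin (3 + 1) → K) + Y * Module.finrank ℚ K) / c)) :=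
  highSatellite3_of pointDatum_of_closeZero ideg_le_mul_of_rankTwo exists_primeFactor_mem

namespace PointAPThreeMid

/-- Accuracy is monotone in the height scale and in the constant. [folklore] -/
theorem exp_datum_mono {h D Δ Y Y' c c' : ℝ} (hh : 0 ≤ h) (hD : 0 ≤ D) (hΔ : 0 ≤ Δ) (hY : 0 ≤ Y)
    (hYY' : Y ≤ Y') (hc' : 0 < c') (hcc' : c' ≤ c) :
    Real.exp (-((Δ * h + Y' * D) / c')) ≤ Real.exp (-((Δ * h + Y * D) / c)) := by
  rw [Real.exp_le_exp, neg_le_neg_iff]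
  have h1 : 0 ≤ Δ * h + Y * D := by positivity
  calc (Δ * h + Y * D) / c ≤ (Δ * h + Y * D) / c' := div_le_div_of_nonneg_left h1 hc' hcc'
    _ ≤ (Δ * h + Y' * D) / c' :=
        div_le_div_of_nonneg_right (by nlinarith [mul_le_mul_of_nonneg_right hYY' hD]) hc'.le

end PointAPThreeMid

open PointAPThreeMid in
/-- **v23b's far stub from the MID stub** (`farSatellite3_def_of_mid`): given the mid-satellite kernel (hypothesis
`hmid` = registered open stub `pointDatum_of_midSatellite3` verbatim), the far ∧ thin ∧ enveloped ∧ deficient kernel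
`pointDatum_of_farSatellite3_def` of skeleton v23b holds — take the mid stub's `δ⋆, K₀, C₄, η`, the landed
`pointDatum_of_highSatellite3` at `(C₄, η)`, multiply the boosts and split at `ηΔ² ≤ deg 𝔮'`. [folklore] -/
theorem farSatellite3_def_of_mid (hmid : ∀ (ω : Fin 3 → ℂ) (c₁ : ℝ), 1 ≤ c₁ → ∃ δstar : ℕ, 1 ≤ δstar ∧ ∃ K₀ : ℕ, 1 ≤ K₀ ∧ ∃ C₄ : ℝ, c₁ ≤ C₄ ∧ ∃ η : ℝ, 0 < η ∧ ∃ lam : ℝ, 1 ≤ lam ∧ ∃ c : ℝ, c₁ ≤ c ∧ ∀ Δ Y : ℝ, c ≤ Δ → Δ ≤ Y → ∀ (Q : Rx 3) (a : ℕ) (P : Rx 3) (b : ℕ) (𝔮 : Ideal (Rx 3)) (T : Rx 3) (τ : ℕ) (𝔭 𝔮' : Ideal (Rx 3)), CycleAP3Datum ω c₁ Δ (lam * Y) Q a P b 𝔮 T τ 𝔭 → 𝔮'.IsPrime → 𝔮'.IsHomogeneous (homogeneousSubmodule (Fin (3 + 1)) ℚ) → IsUnmixedOfRank 𝔮' 2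 → 𝔮' ∈ (Ideal.span {Q} ⊔ Ideal.span {P}).minimalPrimes → Ideal.span {Q} ⊔ Ideal.span {P} ⊔ Ideal.span {T} ≤ 𝔮' → 𝔮' < 𝔭 → δstar < ideg 𝔮' 2 → a + b + ⌊Δ⌋₊ ≤ τ → Module.finrank ℚ ↥(homogeneousSubmodule (Fin (3 + 1)) ℚ τ) < Module.finrank ℚ ↥(homogeneousSubmodule (Fin (3 + 1)) ℚ τ ⊓ 𝔮'.restrictScalars ℚ) + 2 * ⌊Δ⌋₊ * ideg 𝔮 2 → ⌊c₁ * Δ⌋₊ + 1 < ideg 𝔭 1 → ¬ (Module.finrank ℚ ↥(homogeneousSubmodule (Fin (3 + 1)) ℚ ⌊c₁ * Δ⌋₊) = Module.finrank ℚ ↥(homogeneousSubmodule (Fin (3 + 1)) ℚ ⌊c₁ * Δ⌋₊ ⊓ 𝔭.restrictScalars ℚ) + ideg 𝔭 1) → homogeneousSubmodule (Fin (3 + 1)) ℚ ⌊C₄ * Δ⌋₊ ⊓ 𝔭.restrictScalars ℚ ≤ 𝔮'.restrictScalars ℚ → K₀ * Module.finrank ℚ ↥(homogeneousSubmodule (Fin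 (3 + 1)) ℚ ⌊C₄ * Δ⌋₊) < ideg 𝔭 1 + K₀ * Module.finrank ℚ ↥(homogeneousSubmodule (Fin (3 + 1)) ℚ ⌊C₄ * Δ⌋₊ ⊓ 𝔭.restrictScalars ℚ) → (ideg 𝔮' 2 : ℝ) < η * Δ ^ 2 → ∃ (K : Type) (_ : Field K) (_ : NumberField K) (β : Fin 3 → K) (σ : K →+* ℂ), (Module.finrank ℚ K : ℝ) ≤ (c * Δ) ^ 3 ∧ Height.logHeight (Fin.cons (1 : K) β : Fin (3 + 1) → K) ≤ c * Y * Δ ^ 2 ∧ ‖(fun j => σ (β j)) - ω‖ ≤ Real.exp (-((Δ * Height.logHeight (Fin.cons (1 : K) β : Fin (3 + 1) → K) + Y * Module.finrank ℚ K) / c))) : ∀ (ω : Fin 3 → ℂ) (c₁ : ℝ), 1 ≤ c₁ → ∃ δstar : ℕ, 1 ≤ δstar ∧ ∃ K₀ : ℕ, 1 ≤ K₀ ∧ ∃ C₄ : ℝ, c₁ ≤ C₄ ∧ ∃ lam : ℝ, 1 ≤ lam ∧ ∃ c : ℝ, c₁ ≤ c ∧ ∀ Δ Y : ℝ, c ≤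 Δ → Δ ≤ Y → ∀ (Q : Rx 3) (a : ℕ) (P : Rx 3) (b : ℕ) (𝔮 : Ideal (Rx 3)) (T : Rx 3) (τ : ℕ) (𝔭 𝔮' : Ideal (Rx 3)), CycleAP3Datum ω c₁ Δ (lam * Y) Q a P b 𝔮 T τ 𝔭 → 𝔮'.IsPrime → 𝔮'.IsHomogeneous (homogeneousSubmodule (Fin (3 + 1)) ℚ) → IsUnmixedOfRank 𝔮' 2 → 𝔮' ∈ (Ideal.span {Q} ⊔ Ideal.span {P}).minimalPrimes → Ideal.span {Q} ⊔ Ideal.span {P} ⊔ Ideal.span {T} ≤ 𝔮' → 𝔮' < 𝔭 → δstar < ideg 𝔮' 2 → a + b + ⌊Δ⌋₊ ≤ τ → Module.finrank ℚ ↥(homogeneousSubmodule (Fin (3 + 1)) ℚ τ) < Module.finrank ℚ ↥(homogeneousSubmodule (Fin (3 + 1)) ℚ τ ⊓ 𝔮'.restrictScalars ℚ) + 2 * ⌊Δ⌋₊ * ideg 𝔮 2 → ⌊c₁ * Δ⌋₊ + 1 < ideg 𝔭 1 → ¬ (Module.finrank ℚ ↥(homogeneousSubmodule (Fin (3 + 1))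 ℚ ⌊c₁ * Δ⌋₊) = Module.finrank ℚ ↥(homogeneousSubmodule (Fin (3 + 1)) ℚ ⌊c₁ * Δ⌋₊ ⊓ 𝔭.restrictScalars ℚ) + ideg 𝔭 1) → homogeneousSubmodule (Fin (3 + 1)) ℚ ⌊C₄ * Δ⌋₊ ⊓ 𝔭.restrictScalars ℚ ≤ 𝔮'.restrictScalars ℚ → K₀ * Module.finrank ℚ ↥(homogeneousSubmodule (Fin (3 + 1)) ℚ ⌊C₄ * Δ⌋₊) < ideg 𝔭 1 + K₀ * Module.finrank ℚ ↥(homogeneousSubmodule (Fin (3 + 1)) ℚ ⌊C₄ * Δ⌋₊ ⊓ 𝔭.restrictScalars ℚ) → ∃ (K : Type) (_ : Field K) (_ : NumberField K) (β : Fin 3 → K) (σ : K →+* ℂ), (Module.finrank ℚ K : ℝ) ≤ (c * Δ) ^ 3 ∧ Height.logHeight (Fin.cons (1 : K) β : Fin (3 + 1) → K) ≤ c * Y * Δ ^ 2 ∧ ‖(fun j => σ (β j)) - ω‖ ≤ Real.exp (-((Δ * Height.logHeight (Fin.cons (1 : K) β : Fin (3 + 1) → K) + Y * Module.finrank ℚ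 K) / c)) := by
  intro ω c₁ hc₁
  obtain ⟨δstar, hδ, K₀, hK₀, C₄, hC₄, η, hη, lamM, hlamM, cM, hcM, hmid⟩ := hmid ω c₁ hc₁
  obtain ⟨lamH, hlamH, cH, hcH, hhigh⟩ := pointDatum_of_highSatellite3 ω c₁ hc₁ C₄ hC₄ η hη
  have hcM0 : 0 < cM := by linarith
  have hcH0 : 0 < cH := by linarith
  refine ⟨δstar, hδ, K₀, hK₀, C₄, hC₄, lamM * lamH, one_le_mul_of_one_le_of_one_le hlamM hlamH,
    max (cM * lamH) (cH * lamM), ?_, ?_⟩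
  · exact le_trans hcM (le_trans (le_mul_of_one_le_right hcM0.le hlamH) (le_max_left _ _))
  intro Δ Y hΔ hY Q a P b 𝔮 T τ 𝔭 𝔮' hdat h1 h2 h3 h4 h5 h6 h7 h8 h9 h10 h11 h12 h13
  have hcMΔ : cM ≤ Δ := le_trans (le_trans (le_mul_of_one_le_right hcM0.le hlamH) (le_max_left _ _)) hΔ
  have hcHΔ : cH ≤ Δ := le_trans (le_trans (le_mul_of_one_le_right hcH0.le hlamM) (le_max_right _ _)) hΔ
  have hΔ0 : 0 ≤ Δ := by linarith
  have hY0 : 0 ≤ Y := by linarith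
  by_cases hcase : η * Δ ^ 2 ≤ (ideg 𝔮' 2 : ℝ)
  · -- high branch at the height scale `lamM * Y`
    have hY' : Δ ≤ lamM * Y := le_trans hY (le_mul_of_one_le_left hY0 hlamM)
    have hdat' : CycleAP3Datum ω c₁ Δ (lamH * (lamM * Y)) Q a P b 𝔮 T τ 𝔭 := by
      rw [show lamH * (lamM * Y) = lamM * lamH * Y by ring]; exact hdat
    obtain ⟨K, iF, iN, β, σ, hd, hh, hacc⟩ :=
      hhigh Δ (lamM * Y) hcHΔ hY' Q a P b 𝔮 T τ 𝔭 𝔮' hdat' h1 h2 h3 h4 h6.le h12 hcase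
    refine ⟨K, iF, iN, β, σ, ?_, ?_, ?_⟩
    · exact hd.trans (pow_le_pow_left₀ (by positivity)
        (mul_le_mul_of_nonneg_right (le_trans (le_mul_of_one_le_right hcH0.le hlamM) (le_max_right _ _)) hΔ0) 3)
    · calc _ ≤ cH * (lamM * Y) * Δ ^ 2 := hh
        _ = (cH * lamM) * Y * Δ ^ 2 := by ring
        _ ≤ max (cM * lamH) (cH * lamM) * Y * Δ ^ 2 := by gcongr; exact le_max_right _ _
    · exact hacc.trans (exp_datum_mono (Height.logHeight_nonneg _) (Nat.cast_nonneg _) hΔ0 hY0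
        (le_mul_of_one_le_left hY0 hlamM) hcH0
        (le_trans (le_mul_of_one_le_right hcH0.le hlamM) (le_max_right _ _)))
  · -- mid branch at the height scale `lamH * Y`
    have hcase : (ideg 𝔮' 2 : ℝ) < η * Δ ^ 2 := lt_of_not_ge hcase
    have hY' : Δ ≤ lamH * Y := le_trans hY (le_mul_of_one_le_left hY0 hlamH)
    have hdat' : CycleAP3Datum ω c₁ Δ (lamM * (lamH * Y)) Q a P b 𝔮 T τ 𝔭 := by
      rw [show lamM * (lamH * Y) = lamM * lamH * Y by ring]; exact hdat
    obtain ⟨K, iF, iN, β, σ, hd, hh, hacc⟩ :=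
      hmid Δ (lamH * Y) hcMΔ hY' Q a P b 𝔮 T τ 𝔭 𝔮' hdat' h1 h2 h3 h4 h5 h6 h7 h8 h9 h10 h11 h12 h13 hcase
    refine ⟨K, iF, iN, β, σ, ?_, ?_, ?_⟩
    · exact hd.trans (pow_le_pow_left₀ (by positivity)
        (mul_le_mul_of_nonneg_right (le_trans (le_mul_of_one_le_right hcM0.le hlamH) (le_max_left _ _)) hΔ0) 3)
    · calc _ ≤ cM * (lamH * Y) * Δ ^ 2 := hh
        _ = (cM * lamH) * Y * Δ ^ 2 := by ring
        _ ≤ max (cM * lamH) (cH * lamM) * Y * Δ ^ 2 := by gcongr; exact le_max_left _ _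
    · exact hacc.trans (exp_datum_mono (Height.logHeight_nonneg _) (Nat.cast_nonneg _) hΔ0 hY0
        (le_mul_of_one_le_left hY0 hlamH) hcM0
        (le_trans (le_mul_of_one_le_right hcM0.le hlamH) (le_max_left _ _)))

/-- **`PointAPAbsAt 3` from the mid-satellite kernel alone** — Philippon's AP2 for `n = 3` with pointwise constants,
conditionally on the registered open stub `pointDatum_of_midSatellite3` only (landed `pointAPAt3_of_farDef` over
`farSatellite3_def_of_mid`). [cite: NesterenkoPhilippon2001, Ch. 4 §4 (p. 61)] -/
theorem pointAPAt3_of_mid (hmid : ∀ (ω : Fin 3 → ℂ) (c₁ : ℝ), 1 ≤ c₁ → ∃ δstar : ℕ, 1 ≤ δstar ∧ ∃ K₀ : ℕ, 1 ≤ K₀ ∧ ∃ C₄ : ℝ, c₁ ≤ C₄ ∧ ∃ η : ℝ, 0 < η ∧ ∃ lam : ℝ, 1 ≤ lam ∧ ∃ c : ℝ, c₁ ≤ c ∧ ∀ Δ Y : ℝ, c ≤ Δ → Δ ≤ Y → ∀ (Q : Rx 3) (a : ℕ) (P : Rx 3) (b : ℕ) (𝔮 : Ideal (Rx 3)) (T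 : Rx 3) (τ : ℕ) (𝔭 𝔮' : Ideal (Rx 3)), CycleAP3Datum ω c₁ Δ (lam * Y) Q a P b 𝔮 T τ 𝔭 → 𝔮'.IsPrime → 𝔮'.IsHomogeneous (homogeneousSubmodule (Fin (3 + 1)) ℚ) → IsUnmixedOfRank 𝔮' 2 → 𝔮' ∈ (Ideal.span {Q} ⊔ Ideal.span {P}).minimalPrimes → Ideal.span {Q} ⊔ Ideal.span {P} ⊔ Ideal.span {T} ≤ 𝔮' → 𝔮' < 𝔭 → δstar < ideg 𝔮' 2 → a + b + ⌊Δ⌋₊ ≤ τ → Module.finrank ℚ ↥(homogeneousSubmodule (Fin (3 + 1)) ℚ τ) < Module.finrank ℚ ↥(homogeneousSubmodule (Fin (3 + 1)) ℚ τ ⊓ 𝔮'.restrictScalars ℚ) + 2 * ⌊Δ⌋₊ * ideg 𝔮 2 → ⌊c₁ * Δ⌋₊ + 1 < ideg 𝔭 1 → ¬ (Module.finrank ℚ ↥(homogeneousSubmodule (Fin (3 + 1)) ℚ ⌊c₁ * Δ⌋₊) = Module.finrank ℚ ↥(homogeneousSubmodule (Fin (3 + 1)) ℚ ⌊c₁ *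 Δ⌋₊ ⊓ 𝔭.restrictScalars ℚ) + ideg 𝔭 1) → homogeneousSubmodule (Fin (3 + 1)) ℚ ⌊C₄ * Δ⌋₊ ⊓ 𝔭.restrictScalars ℚ ≤ 𝔮'.restrictScalars ℚ → K₀ * Module.finrank ℚ ↥(homogeneousSubmodule (Fin (3 + 1)) ℚ ⌊C₄ * Δ⌋₊) < ideg 𝔭 1 + K₀ * Module.finrank ℚ ↥(homogeneousSubmodule (Fin (3 + 1)) ℚ ⌊C₄ * Δ⌋₊ ⊓ 𝔭.restrictScalars ℚ) → (ideg 𝔮' 2 : ℝ) < η * Δ ^ 2 → ∃ (K : Type) (_ : Field K) (_ : NumberField K) (β : Fin 3 → K) (σ : K →+* ℂ), (Module.finrank ℚ K : ℝ) ≤ (c * Δ) ^ 3 ∧ Height.logHeight (Fin.cons (1 : K) β : Fin (3 + 1) → K) ≤ c * Y * Δ ^ 2 ∧ ‖(fun j => σ (β j)) - ω‖ ≤ Real.exp (-((Δ * Height.logHeight (Fin.cons (1 : K) β : Fin (3 + 1) → K) + Y * Module.finrank ℚ K) / c))) : PointAPAbsAt 3 :=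
  pointAPAt3_of_farDef (farSatellite3_def_of_mid hmid)

/-- **The `t = 3` slice of the crux from the mid-satellite kernel alone** (landed `slice_three_of_farDef`).
[cite: NesterenkoPhilippon2001, Ch. 4 §4 (p. 61)] -/
theorem slice_three_of_mid (hmid : ∀ (ω : Fin 3 → ℂ) (c₁ : ℝ), 1 ≤ c₁ → ∃ δstar : ℕ, 1 ≤ δstar ∧ ∃ K₀ : ℕ, 1 ≤ K₀ ∧ ∃ C₄ : ℝ, c₁ ≤ C₄ ∧ ∃ η : ℝ, 0 < η ∧ ∃ lam : ℝ, 1 ≤ lam ∧ ∃ c : ℝ, c₁ ≤ c ∧ ∀ Δ Y : ℝ, c ≤ Δ → Δ ≤ Y → ∀ (Q : Rx 3) (a : ℕ) (P : Rx 3) (b : ℕ) (𝔮 : Ideal (Rx 3)) (T : Rx 3) (τ : ℕ) (𝔭 𝔮' : Ideal (Rx 3)), CycleAP3Datum ω c₁ Δ (lam * Y) Q a P b 𝔮 T τ 𝔭 → 𝔮'.IsPrime → 𝔮'.IsHomogeneous (homogeneousSubmodule (Fin (3 + 1)) ℚ) → IsUnmixedOfRank 𝔮' 2 → 𝔮' ∈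 (Ideal.span {Q} ⊔ Ideal.span {P}).minimalPrimes → Ideal.span {Q} ⊔ Ideal.span {P} ⊔ Ideal.span {T} ≤ 𝔮' → 𝔮' < 𝔭 → δstar < ideg 𝔮' 2 → a + b + ⌊Δ⌋₊ ≤ τ → Module.finrank ℚ ↥(homogeneousSubmodule (Fin (3 + 1)) ℚ τ) < Module.finrank ℚ ↥(homogeneousSubmodule (Fin (3 + 1)) ℚ τ ⊓ 𝔮'.restrictScalars ℚ) + 2 * ⌊Δ⌋₊ * ideg 𝔮 2 → ⌊c₁ * Δ⌋₊ + 1 < ideg 𝔭 1 → ¬ (Module.finrank ℚ ↥(homogeneousSubmodule (Fin (3 + 1)) ℚ ⌊c₁ * Δ⌋₊) = Module.finrank ℚ ↥(homogeneousSubmodule (Fin (3 + 1)) ℚ ⌊c₁ * Δ⌋₊ ⊓ 𝔭.restrictScalars ℚ) + ideg 𝔭 1) → homogeneousSubmodule (Fin (3 + 1)) ℚ ⌊C₄ * Δ⌋₊ ⊓ 𝔭.restrictScalars ℚ ≤ 𝔮'.restrictScalars ℚ → K₀ * Module.finrank ℚ ↥(homogeneousSubmodule (Fin (3 + 1)) ℚ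 ⌊C₄ * Δ⌋₊) < ideg 𝔭 1 + K₀ * Module.finrank ℚ ↥(homogeneousSubmodule (Fin (3 + 1)) ℚ ⌊C₄ * Δ⌋₊ ⊓ 𝔭.restrictScalars ℚ) → (ideg 𝔮' 2 : ℝ) < η * Δ ^ 2 → ∃ (K : Type) (_ : Field K) (_ : NumberField K) (β : Fin 3 → K) (σ : K →+* ℂ), (Module.finrank ℚ K : ℝ) ≤ (c * Δ) ^ 3 ∧ Height.logHeight (Fin.cons (1 : K) β : Fin (3 + 1) → K) ≤ c * Y * Δ ^ 2 ∧ ‖(fun j => σ (β j)) - ω‖ ≤ Real.exp (-((Δ * Height.logHeight (Fin.cons (1 : K) β : Fin (3 + 1) → K) + Y * Module.finrank ℚ K) / c))) : PointwiseAPSlice 3 :=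
  slice_three_of_farDef (farSatellite3_def_of_mid hmid)

/-- **Registered sub-goal `approximationProperty_of_mid` — the crux's exact residual after v24/v25**: the mid-satellite
kernel at `n = 3` (registered open stub `pointDatum_of_midSatellite3`) and Philippon's conjecture AP1/AP2 for `n ≥ 4`
(registered open stub `stub_pointAP_four_le`) imply `ApproximationProperty` (landed `approximationProperty_of_farDef`
over `farSatellite3_def_of_mid`). [cite: NesterenkoPhilippon2001, Ch. 4 §4 (p. 61)] -/
theorem approximationProperty_of_mid : (∀ (ω : Fin 3 → ℂ) (c₁ : ℝ), 1 ≤ c₁ → ∃ δstar : ℕ, 1 ≤ δstar ∧ ∃ K₀ : ℕ, 1 ≤ K₀ ∧ ∃ C₄ : ℝ, c₁ ≤ C₄ ∧ ∃ η : ℝ, 0 < η ∧ ∃ lam : ℝ, 1 ≤ lam ∧ ∃ c : ℝ, c₁ ≤ c ∧ ∀ Δ Y : ℝ, c ≤ Δ → Δ ≤ Y → ∀ (Q : Rx 3) (a : ℕ) (P : Rx 3) (b : ℕ) (𝔮 : Ideal (Rx 3)) (T : Rx 3) (τ : ℕ) (𝔭 𝔮' : Ideal (Rx 3)), CycleAP3Datum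 ω c₁ Δ (lam * Y) Q a P b 𝔮 T τ 𝔭 → 𝔮'.IsPrime → 𝔮'.IsHomogeneous (homogeneousSubmodule (Fin (3 + 1)) ℚ) → IsUnmixedOfRank 𝔮' 2 → 𝔮' ∈ (Ideal.span {Q} ⊔ Ideal.span {P}).minimalPrimes → Ideal.span {Q} ⊔ Ideal.span {P} ⊔ Ideal.span {T} ≤ 𝔮' → 𝔮' < 𝔭 → δstar < ideg 𝔮' 2 → a + b + ⌊Δ⌋₊ ≤ τ → Module.finrank ℚ ↥(homogeneousSubmodule (Fin (3 + 1)) ℚ τ) < Module.finrank ℚ ↥(homogeneousSubmodule (Fin (3 + 1)) ℚ τ ⊓ 𝔮'.restrictScalars ℚ) + 2 * ⌊Δ⌋₊ * ideg 𝔮 2 → ⌊c₁ * Δ⌋₊ + 1 < ideg 𝔭 1 → ¬ (Module.finrank ℚ ↥(homogeneousSubmodule (Fin (3 + 1)) ℚ ⌊c₁ * Δ⌋₊) = Module.finrank ℚ ↥(homogeneousSubmodule (Fin (3 + 1)) ℚ ⌊c₁ * Δ⌋₊ ⊓ 𝔭.restrictScalars ℚ) + ideg 𝔭 1) → homogeneousSubmodule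 (Fin (3 + 1)) ℚ ⌊C₄ * Δ⌋₊ ⊓ 𝔭.restrictScalars ℚ ≤ 𝔮'.restrictScalars ℚ → K₀ * Module.finrank ℚ ↥(homogeneousSubmodule (Fin (3 + 1)) ℚ ⌊C₄ * Δ⌋₊) < ideg 𝔭 1 + K₀ * Module.finrank ℚ ↥(homogeneousSubmodule (Fin (3 + 1)) ℚ ⌊C₄ * Δ⌋₊ ⊓ 𝔭.restrictScalars ℚ) → (ideg 𝔮' 2 : ℝ) < η * Δ ^ 2 → ∃ (K : Type) (_ : Field K) (_ : NumberField K) (β : Fin 3 → K) (σ : K →+* ℂ), (Module.finrank ℚ K : ℝ) ≤ (c * Δ) ^ 3 ∧ Height.logHeight (Fin.cons (1 : K) β : Fin (3 + 1) → K) ≤ c * Y * Δ ^ 2 ∧ ‖(fun j => σ (β j)) - ω‖ ≤ Real.exp (-((Δ * Height.logHeight (Fin.cons (1 : K) β : Fin (3 + 1) → K) + Y * Module.finrank ℚ K) / c))) → (∀ t : ℕ, 4 ≤ t → PointAPAbsAt t) → ApproximationProperty :=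
  fun hmid h4 => approximationProperty_of_farDef (farSatellite3_def_of_mid hmid) h4

end Summit.Schanuel.Schanuel.Cruxes.ApproximationProperty.OrbitInterpolationDeterminant

end
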